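import Summits.BirchSwinnertonDyer.Rank1Residual.Additive.CuspDivisionPolynomialFiveSeven
import Literature.NumberTheory.EllipticCurves.MazurTorsionStepOneAtNProofs
import HarnessLib

/-!
# No `p`-torsion in `E(ℚ_p)` at an ADDITIVE prime `p ≥ 5`, SHORT MODEL `y² = x³ + ax + b`:
# Mazur's Step 1 at `q = N` extended to `N ∈ {5, 7}` (unit-abscissa case at `5` and `7`, trichotomy)

HONEST FRAMING (cell `b2b-bsdres`, run/shared/lean/b2b/bsd-rank1-residual/, verbatim in every
file): the goal of the cell is to DELETE the COMBINATION-SHAPED residual classes of the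
Birch–Swinnerton-Dyer formula for ALL analytic-rank `≤ 1` elliptic curves over `ℚ` — "full BSD
formula for every rank `≤ 1` curve in class `C`" assembled STRICTLY from published theorems — so
that the rank-`≤ 1` remainder becomes exactly the CONSTRUCTION-SHAPED classes, which are TYPED
(missing-input `Prop`s), NOT attempted. This is not "finishing BSD". Sub-cell `additive-p2`
(X3♯(G-ord) / X4♯(G-ord)), generation 37: research route; no claim beyond the stated classes;
TOOL theorems on local points only, no definition, no named fact, nothing booked, no label moved.

## What and why

The tree's `Literature.NumberTheory.EllipticCurves.not_prime_zsmul_eq_zero_of_hasAdditiveReduction`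
(Mazur 1977, Ch. III §5, Step 1 at `q = N`, elementary proof) says: over `ℚ_p`, `p ≥ 11`, an
elliptic curve whose minimal model has ADDITIVE reduction has no `ℚ_p`-point `P ≠ O` with
`p • P = O`.  The bound `p ≥ 11` enters only in the unit-abscissa case, through the first-order
cusp expansion `ψ_p(x) ≡ p·x^{(p²−1)/2} (mod p²)` with `840 = 2³·3·5·7` inverted.  The (G)-cell
of this sub-cell lives at `p ∈ {5, 7, 13, …}` with most of its mass at `5` (defect `4`) and `7`
(defects `3, 6`), so the primes `5` and `7` are exactly the ones that matter here; and at them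
`p`-torsion with additive reduction DOES occur (`X₁(5)`: `y² − 2xy − 3y = x³ − 3x²`, type II at
`5`; `X₁(7)` at `d = 5`: `[−19, −100, −100, 0, 0]`, conductor `490`, type II at `7`).  With the
integer first-order expansions of `ψ₅`, `ψ₇` (`Additive/CuspDivisionPolynomialFiveSeven`:
`ψ₅ ≡ 5x¹² + 380·b·x⁹ (mod (a, b²))`, `ψ₇ ≡ 7x²⁴ + 308·a·x²² (mod (a², b))`, `5 ∣ 380`, `7 ∣ 308`)
the same trichotomy proves, for the short minimal model `y² = x³ + ax + b` (`a, b ∈ pℤ_p`):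

* `not_prime_zsmul_eq_zero_of_norm_eq_one_five` / `_seven` — at `p = 5` with `25 ∣ a`, resp. at
  `p = 7` with `49 ∣ b`, a point with UNIT abscissa is not killed by `p`
  (`ψ_p(x) ≡ p·x^{(p²−1)/2} (mod p²)` again);
* `not_prime_zsmul_eq_zero_of_short'` — the trichotomy (non-integral abscissa: `E₁(ℚ_p)[p] = 0`,
  tree; cusp: Kodaira–Néron `[E : E₀] ≤ 4`, tree; unit abscissa: the above / the tree at `p ≥ 11`)
  for every prime `p ≥ 5` under the hypotheses `p = 5 → 25 ∣ a`, `p = 7 → 49 ∣ b`.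

The passage to an ARBITRARY additive minimal model (`toShortNF`, `c₄ = −48a`, `c₆ = −864b`) and
the exceptional locus `(p = 5 ∧ ‖c₄‖ = 5⁻¹) ∨ (p = 7 ∧ ‖c₆‖ = 7⁻¹)` are in
`Additive/LocalTorsionAdditiveFiveSeven`; the `ℚ`-curve consequences for the cell in
`Additive/AdditiveTorsionFiveSeven`.

References: [Mazur1977] B. Mazur, *Modular curves and the Eisenstein ideal*, Publ. Math. IHÉS 47
(1977), Ch. III §5, Step 1, p. 158. [SilvermanAEC2009] J. H. Silverman, *AEC* 2nd ed., VII.3.1,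
IV.6.1, Exercise 3.7; [SilvermanATAEC1994] Cor. IV.9.2(d). M. Flexor, J. Oesterlé, *Sur les points
de torsion des courbes elliptiques*, Astérisque 183 (1990) 25–36 (torsion vs. additive reduction,
`#E(K)_tors ≤ 48 e` — cited for context; the statements here are proved from the tree).
-/

noncomputable section

open scoped Classical

namespace Summit.BirchSwinnertonDyer.Rank1Residual.Additive.CuspTorsion

open WeierstrassCurve Polynomial Literature.NumberTheory.EllipticCurves
  Literature.NumberTheory.EllipticCurves.CuspJets

variable {p : ℕ} [Fact p.Prime]

/-! ## §1 `ψ_p(x₀) = 0` for a unit-abscissa `p`-torsion point (any odd `p`) -/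

/-- On `y² = x³ + ax + b` over `ℤ_p` (`p` odd), if the point `(x₀, y₀)` with `x₀, y₀ ∈ ℤ_p` is killed
by `p` then `ψ_p(x₀) = 0` in `ℤ_p` (`p • P = O ↔ ψ_p(P) = 0`, `ψ_p² = preΨ_p²` for odd `p`,
injectivity of `ℤ_p → ℚ_p`). [cite: SilvermanAEC2009, Exercise 3.7(d),(f) (PDF pp. 97–98)] -/
theorem eval_preΨ'_eq_zero_of_prime_zsmul_eq_zero (hp3 : 3 ≤ p) {A B : ℤ_[p]}
    [((shortCurve A B).baseChange ℚ_[p]).IsElliptic] {x₀ y₀ : ℤ_[p]}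
    (h : ((shortCurve A B).baseChange ℚ_[p]).toAffine.Nonsingular
      (algebraMap ℤ_[p] ℚ_[p] x₀) (algebraMap ℤ_[p] ℚ_[p] y₀))
    (h0 : (p : ℤ) • (Affine.Point.some _ _ h :
      ((shortCurve A B).baseChange ℚ_[p]).toAffine.Point) = 0) :
    ((shortCurve A B).preΨ' p).eval x₀ = 0 := by
  obtain ⟨j, hj⟩ := exists_eq_two_mul_add_three (p := p) hp3
  have hodd : ¬ Even p := by rw [hj, Nat.not_even_iff_odd]; exact ⟨j + 1, by ring⟩
  rw [zsmul_eq_zero_iff_evalEval_ψ_holds ((shortCurve A B).baseChange ℚ_[p]) (p : ℤ) h] at h0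
  have h1 := evalEval_ψ_sq ((shortCurve A B).baseChange ℚ_[p]) h.1 (p : ℤ)
  rw [h0, zero_pow two_ne_zero, ΨSq_ofNat, if_neg hodd, mul_one, eval_pow, eq_comm,
    pow_eq_zero_iff two_ne_zero, show ((shortCurve A B).baseChange ℚ_[p]).preΨ' p =
      ((shortCurve A B).preΨ' p).map (algebraMap ℤ_[p] ℚ_[p]) from
        map_preΨ' (shortCurve A B) (algebraMap ℤ_[p] ℚ_[p]) p,
    eval_map, eval₂_at_apply, map_eq_zero_iff _ (IsFractionRing.injective ℤ_[p] ℚ_[p])] at h1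
  exact h1

/-- If `p·u ∈ (p²)` in `ℤ_p` then `‖u‖ < 1`. [folklore] -/
theorem norm_lt_one_of_prime_mul_mem_span_sq {u : ℤ_[p]}
    (hu : (p : ℤ_[p]) * u ∈ Ideal.span ({(p : ℤ_[p]) ^ 2} : Set ℤ_[p])) : ‖u‖ < 1 := by
  rw [Ideal.mem_span_singleton] at hu
  obtain ⟨t, ht⟩ := hu
  have hp0 : (p : ℤ_[p]) ≠ 0 := by exact_mod_cast (Fact.out : p.Prime).ne_zero
  have hu' : u = (p : ℤ_[p]) * t := by
    apply mul_left_cancel₀ hp0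
    rw [ht]; ring
  rw [hu', norm_mul, PadicInt.norm_p]
  exact mul_lt_one_of_nonneg_of_lt_one_left (by positivity)
    (inv_lt_one_of_one_lt₀ (by exact_mod_cast (Fact.out : p.Prime).one_lt)) (PadicInt.norm_le_one _)

/-! ## §2 The unit-abscissa case at `p = 5` and `p = 7` -/

/-- **`p = 5`: on `y² = x³ + ax + b` over `ℤ₅` with `25 ∣ a` and `5 ∣ b`, a point with unit
abscissa is not killed by `5`.** If it were, `ψ₅(x₀) = 0`; but
`ψ₅(x₀) ≡ 5x₀¹² + 380·b·x₀⁹ (mod (a, b²))` (`Additive/CuspDivisionPolynomialFiveSeven`) and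
`(a, b²) + (380 b) ⊆ (25)`, so `5x₀¹² ∈ (25)`, `x₀ ∉ ℤ₅ˣ`.
[cite: SilvermanAEC2009, Exercise 3.7(d),(f) (PDF pp. 97–98); Mazur1977, Ch. III §5, Step 1, p. 158] -/
theorem not_prime_zsmul_eq_zero_of_norm_eq_one_five (hp : p = 5) {A B : ℤ_[p]}
    (hA : (p : ℤ_[p]) ^ 2 ∣ A) (hB : (p : ℤ_[p]) ∣ B)
    [((shortCurve A B).baseChange ℚ_[p]).IsElliptic] {x₀ y₀ : ℤ_[p]} (hx : ‖x₀‖ = 1)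
    (h : ((shortCurve A B).baseChange ℚ_[p]).toAffine.Nonsingular
      (algebraMap ℤ_[p] ℚ_[p] x₀) (algebraMap ℤ_[p] ℚ_[p] y₀)) :
    (p : ℤ) • (Affine.Point.some _ _ h :
      ((shortCurve A B).baseChange ℚ_[p]).toAffine.Point) ≠ 0 := by
  intro h0
  have h1 := eval_preΨ'_eq_zero_of_prime_zsmul_eq_zero (by omega) h h0
  subst hp
  have key := eval_preΨ'_five_sub_mem A B x₀
  rw [h1, zero_sub, neg_mem_iff] at key
  -- `(a, b²) ⊆ (25)`
  obtain ⟨B', rfl⟩ := hB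
  have hle : Ideal.span ({A, (((5 : ℕ) : ℤ_[5]) * B') ^ 2} : Set ℤ_[5]) ≤
      Ideal.span {((5 : ℕ) : ℤ_[5]) ^ 2} := by
    rw [Ideal.span_le]
    rintro z (rfl | rfl)
    · exact Ideal.mem_span_singleton.mpr hA
    · exact Ideal.mem_span_singleton.mpr ⟨B' ^ 2, by ring⟩
  have hmem : ((5 : ℕ) : ℤ_[5]) * x₀ ^ 12 ∈ Ideal.span ({((5 : ℕ) : ℤ_[5]) ^ 2} : Set ℤ_[5]) := by
    have e : ((5 : ℕ) : ℤ_[5]) * x₀ ^ 12 =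
        (5 * x₀ ^ 12 + 380 * (((5 : ℕ) : ℤ_[5]) * B') * x₀ ^ 9) -
          ((5 : ℕ) : ℤ_[5]) ^ 2 * (76 * B' * x₀ ^ 9) := by
      push_cast; ring
    rw [e]
    exact sub_mem (hle key) (Ideal.mem_span_singleton.mpr (dvd_mul_right _ _))
  have hn := norm_lt_one_of_prime_mul_mem_span_sq hmem
  rw [norm_pow, hx, one_pow] at hn
  exact lt_irrefl _ hn

/-- **`p = 7`: on `y² = x³ + ax + b` over `ℤ₇` with `7 ∣ a` and `49 ∣ b`, a point with unit
abscissa is not killed by `7`.** If it were, `ψ₇(x₀) = 0`; but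
`ψ₇(x₀) ≡ 7x₀²⁴ + 308·a·x₀²² (mod (a², b))` (`Additive/CuspDivisionPolynomialFiveSeven`) and
`(a², b) + (308 a) ⊆ (49)`, so `7x₀²⁴ ∈ (49)`, `x₀ ∉ ℤ₇ˣ`.
[cite: SilvermanAEC2009, Exercise 3.7(d),(f) (PDF pp. 97–98); Mazur1977, Ch. III §5, Step 1, p. 158] -/
theorem not_prime_zsmul_eq_zero_of_norm_eq_one_seven (hp : p = 7) {A B : ℤ_[p]}
    (hA : (p : ℤ_[p]) ∣ A) (hB : (p : ℤ_[p]) ^ 2 ∣ B)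
    [((shortCurve A B).baseChange ℚ_[p]).IsElliptic] {x₀ y₀ : ℤ_[p]} (hx : ‖x₀‖ = 1)
    (h : ((shortCurve A B).baseChange ℚ_[p]).toAffine.Nonsingular
      (algebraMap ℤ_[p] ℚ_[p] x₀) (algebraMap ℤ_[p] ℚ_[p] y₀)) :
    (p : ℤ) • (Affine.Point.some _ _ h :
      ((shortCurve A B).baseChange ℚ_[p]).toAffine.Point) ≠ 0 := by
  intro h0
  have h1 := eval_preΨ'_eq_zero_of_prime_zsmul_eq_zero (by omega) h h0
  subst hp
  have key := eval_preΨ'_seven_sub_mem A B x₀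
  rw [h1, zero_sub, neg_mem_iff] at key
  -- `(a², b) ⊆ (49)`
  obtain ⟨A', rfl⟩ := hA
  have hle : Ideal.span ({(((7 : ℕ) : ℤ_[7]) * A') ^ 2, B} : Set ℤ_[7]) ≤
      Ideal.span {((7 : ℕ) : ℤ_[7]) ^ 2} := by
    rw [Ideal.span_le]
    rintro z (rfl | rfl)
    · exact Ideal.mem_span_singleton.mpr ⟨A' ^ 2, by ring⟩
    · exact Ideal.mem_span_singleton.mpr hB
  have hmem : ((7 : ℕ) : ℤ_[7]) * x₀ ^ 24 ∈ Ideal.span ({((7 : ℕ) : ℤ_[7]) ^ 2} : Set ℤ_[7]) := by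
    have e : ((7 : ℕ) : ℤ_[7]) * x₀ ^ 24 =
        (7 * x₀ ^ 24 + 308 * (((7 : ℕ) : ℤ_[7]) * A') * x₀ ^ 22) -
          ((7 : ℕ) : ℤ_[7]) ^ 2 * (44 * A' * x₀ ^ 22) := by
      push_cast; ring
    rw [e]
    exact sub_mem (hle key) (Ideal.mem_span_singleton.mpr (dvd_mul_right _ _))
  have hn := norm_lt_one_of_prime_mul_mem_span_sq hmem
  rw [norm_pow, hx, one_pow] at hn
  exact lt_irrefl _ hn

/-! ## §3 The trichotomy for every prime `p ≥ 5` -/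

/-- A prime `p ≥ 5` is `5`, `7`, or `≥ 11`. [folklore] -/
theorem eq_five_or_eq_seven_or_eleven_le (hp5 : 5 ≤ p) : p = 5 ∨ p = 7 ∨ 11 ≤ p := by
  have hP : p.Prime := Fact.out
  rcases (show p = 5 ∨ p = 6 ∨ p = 7 ∨ p = 8 ∨ p = 9 ∨ p = 10 ∨ 11 ≤ p by omega) with
    h | h | h | h | h | h | h
  · exact Or.inl h
  · exact absurd hP (by rw [h]; decide)
  · exact Or.inr (Or.inl h)
  · exact absurd hP (by rw [h]; decide)
  · exact absurd hP (by rw [h]; decide)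
  · exact absurd hP (by rw [h]; decide)
  · exact Or.inr (Or.inr h)

/-- **The core case, every `p ≥ 5`**: on a minimal short equation `y² = x³ + ax + b` over `ℚ_p` with
`a, b ∈ pℤ_p`, and `25 ∣ a` if `p = 5`, `49 ∣ b` if `p = 7`, no point other than `O` is killed by
`p`. Trichotomy on `x(P)` exactly as the tree's `not_prime_zsmul_eq_zero_of_short` (`p ≥ 11`):
non-integral (`not_prime_zsmul_eq_zero_of_one_lt_norm`, `E₁(ℚ_p)[p] = 0`), unit (§2 at `5`, `7`;
the tree at `p ≥ 11`), or in `pℤ_p` — then `P` reduces to the cusp and lies outside `E₀`, and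
`p • P = O` would force split multiplicative reduction by Kodaira–Néron
(`hasSplitMultiplicativeReduction_of_not_mem_goodReductionSubgroup`, `[E : E₀] ≤ 4 < p`), whereas
`c₄ = −48a ∈ pℤ_p`.
[cite: Mazur1977, Ch. III §5, Step 1, p. 158; SilvermanATAEC1994, Cor. IV.9.2(d) (PDF p. 340)] -/
theorem not_prime_zsmul_eq_zero_of_short' (hp5 : 5 ≤ p) {A B : ℤ_[p]} (hA : ‖A‖ < 1)
    (hB : ‖B‖ < 1) (h5 : p = 5 → (p : ℤ_[p]) ^ 2 ∣ A) (h7 : p = 7 → (p : ℤ_[p]) ^ 2 ∣ B)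
    (V : WeierstrassCurve ℚ_[p])
    (hV : V = (shortCurve A B).baseChange ℚ_[p]) [V.IsElliptic] [V.IsMinimal ℤ_[p]]
    {P : V.toAffine.Point} (hP0 : P ≠ 0) : (p : ℤ) • P ≠ 0 := by
  rcases eq_five_or_eq_seven_or_eleven_le hp5 with hp | hp | h11
  rotate_right
  · exact not_prime_zsmul_eq_zero_of_short h11 hA hB V hV hP0
  all_goals
    subst hV
    have hP' : p.Prime := Fact.out
    rcases P with _ | ⟨x, y, h⟩
    · exact absurd rfl hP0
    by_cases hx : 1 < ‖x‖
    · exact not_prime_zsmul_eq_zero_of_one_lt_norm (by omega) (shortCurve A B) h hx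
    push Not at hx
    have hy : ‖y‖ ≤ 1 := norm_y_le_one' (shortCurve A B) h.1 hx
    obtain ⟨x₀, rfl⟩ : ∃ x₀ : ℤ_[p], algebraMap ℤ_[p] ℚ_[p] x₀ = x := ⟨⟨x, hx⟩, rfl⟩
    obtain ⟨y₀, rfl⟩ : ∃ y₀ : ℤ_[p], algebraMap ℤ_[p] ℚ_[p] y₀ = y := ⟨⟨y, hy⟩, rfl⟩
    by_cases hx1 : ‖x₀‖ = 1
    · first
        | exact not_prime_zsmul_eq_zero_of_norm_eq_one_five hp (h5 hp)
            ((PadicInt.norm_lt_one_iff_dvd B).mp hB) hx1 h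
        | exact not_prime_zsmul_eq_zero_of_norm_eq_one_seven hp
            ((PadicInt.norm_lt_one_iff_dvd A).mp hA) (h7 hp) hx1 h
    have hx0 : ‖x₀‖ < 1 := lt_of_le_of_ne (PadicInt.norm_le_one _) hx1
    -- the equation in `ℤ_p`: `y₀² = x₀³ + A x₀ + B`, so `y₀ ∈ pℤ_p` as well
    have heq : y₀ ^ 2 = x₀ ^ 3 + A * x₀ + B := by
      have h1 : algebraMap ℤ_[p] ℚ_[p] y₀ ^ 2 +
          algebraMap ℤ_[p] ℚ_[p] 0 * algebraMap ℤ_[p] ℚ_[p] x₀ * algebraMap ℤ_[p] ℚ_[p] y₀ +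
          algebraMap ℤ_[p] ℚ_[p] 0 * algebraMap ℤ_[p] ℚ_[p] y₀ =
          algebraMap ℤ_[p] ℚ_[p] x₀ ^ 3 + algebraMap ℤ_[p] ℚ_[p] 0 * algebraMap ℤ_[p] ℚ_[p] x₀ ^ 2 +
          algebraMap ℤ_[p] ℚ_[p] A * algebraMap ℤ_[p] ℚ_[p] x₀ + algebraMap ℤ_[p] ℚ_[p] B :=
        (Affine.equation_iff _ _).mp h.1
      apply IsFractionRing.injective ℤ_[p] ℚ_[p]
      simp only [map_pow, map_add, map_mul]
      simp only [map_zero, zero_mul, add_zero] at h1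
      exact h1
    have hy0 : ‖y₀‖ < 1 := by
      have h1 : ‖y₀ ^ 2‖ < 1 := by
        rw [heq]
        refine (PadicInt.nonarchimedean _ _).trans_lt (max_lt ((PadicInt.nonarchimedean _ _).trans_lt
          (max_lt ?_ ?_)) hB)
        · rw [norm_pow]; exact pow_lt_one₀ (norm_nonneg _) hx0 three_ne_zero
        · rw [norm_mul]; exact mul_lt_one_of_nonneg_of_lt_one_left (norm_nonneg _) hA
            (PadicInt.norm_le_one _)
      rw [norm_pow] at h1
      by_contra hy1
      rw [le_antisymm (PadicInt.norm_le_one _) (not_lt.mp hy1), one_pow] at h1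
      exact lt_irrefl _ h1
    intro hkill
    -- `P ∉ E₀`: it reduces to the cusp `(0, 0)` of `ȳ² = x̄³`
    have hv := integers_valuationRing_valuation ℤ_[p] ℚ_[p]
    have hnotin : (Affine.Point.some _ _ h : ((shortCurve A B).baseChange ℚ_[p]).toAffine.Point) ∉
        ((shortCurve A B).baseChange ℚ_[p]).goodReductionSubgroup ℤ_[p] := by
      rw [goodReductionSubgroup_baseChange_eq, mem_nonsingularReductionSubgroup_iff,
        hasNonsingularReduction_some_algebraMap_iff hv.hom_inj,
        (IsLocalRing.residue_eq_zero_iff _).mpr (PadicInt.mem_nonunits.mpr hx0),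
        (IsLocalRing.residue_eq_zero_iff _).mpr (PadicInt.mem_nonunits.mpr hy0),
        Affine.nonsingular_zero]
      rintro ⟨-, h3 | h4⟩
      · exact h3 (map_zero (IsLocalRing.residue ℤ_[p]))
      · exact h4 ((IsLocalRing.residue_eq_zero_iff A).mpr (PadicInt.mem_nonunits.mpr hA))
    haveI : Finite (IsLocalRing.ResidueField ℤ_[p]) :=
      Finite.of_equiv (ZMod p) (PadicInt.residueField (p := p)).symm.toEquiv
    haveI : PerfectField (IsLocalRing.ResidueField ℤ_[p]) := PerfectField.ofFinite
    obtain ⟨hsplit, -⟩ := hasSplitMultiplicativeReduction_of_not_mem_goodReductionSubgroup ℤ_[p]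
      ((shortCurve A B).baseChange ℚ_[p]) hP' (by omega)
      (P := Affine.Point.some _ _ h) (by rw [← natCast_zsmul]; exact hkill) hnotin
    have hmult := hsplit.toHasMultiplicativeReduction.multiplicativeReduction
    have ec : ((shortCurve A B).baseChange ℚ_[p]).c₄ =
        algebraMap ℤ_[p] ℚ_[p] (shortCurve A B).c₄ :=
      map_c₄ (shortCurve A B) (algebraMap ℤ_[p] ℚ_[p])
    rw [ec, (shortCurve_c₄_Δ A B).1,
      IsDedekindDomain.HeightOneSpectrum.valuation_eq_one_iff_notMem] at hmult
    refine hmult (PadicInt.mem_nonunits.mpr ?_)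
    rw [show (-48 : ℤ_[p]) * A = -(48 * A) by ring, norm_neg, norm_mul]
    exact mul_lt_one_of_nonneg_of_lt_one_right (PadicInt.norm_le_one _) (norm_nonneg _) hA

end Summit.BirchSwinnertonDyer.Rank1Residual.Additive.CuspTorsion

end
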